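import Mathlib.Analysis.Complex.Periodic
import Mathlib.Analysis.Complex.RemovableSingularity
import Mathlib.Analysis.Complex.Liouville
import Mathlib.Analysis.SpecialFunctions.Pow.Asymptotics
import HarnessLib

/-!
# Liouville's theorem for periodic entire functions of tempered growth
(stub S1 `stub_periodicTemperedLiouville` of the line `Sketch`, card `complex-circle-rotation-liouville`,
for the crux `MoebiusLimitExists`, item stmt-CriticalPhenomena-1344; pure one-variable complex
analysis, Mathlib only)

**Statement.** A `2π`-periodic entire function `F : ℂ → ℂ` with at most polynomial growth in
`|im z|`, i.e. `‖F z‖ ≤ C * (1 + |im z|) ^ N` for all `z`, is constant.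

**Proof** (classical: q-expansion + Riemann's removable singularity theorem + Liouville).
`F` factors through `q = 𝕢 z = exp (I z)`: with `G := Function.Periodic.cuspFunction (2π) F`
(`Mathlib.Analysis.Complex.Periodic`) one has `G (𝕢 z) = F z`, and `G` is holomorphic on `ℂ ∖ {0}`
(`Function.Periodic.differentiableAt_cuspFunction`). Since `|im (invQParam (2π) q)| = |log ‖q‖|`,
the growth bound gives `‖G q‖ ≤ C * (1 + |log ‖q‖|) ^ N = o(‖q‖⁻¹)` as `q → 0`, so `0` is a
removable singularity (`Complex.differentiableOn_update_limUnder_of_isLittleO`; the cusp function is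
by definition the `update … (limUnder …)` of that theorem) and `G` is entire. Applying the same to
the reflected function `z ↦ F (-z)` (entire, `2π`-periodic, same growth) yields an entire `G⁻` with
`G q = G⁻ q⁻¹` for `q ≠ 0` (`𝕢 (-z) = (𝕢 z)⁻¹`); hence `G` is bounded on `ℂ` (by its bound on the
closed unit disc and that of `G⁻`), so `G` is constant by Liouville
(`Differentiable.apply_eq_apply_of_bounded`), and `F z = G (𝕢 z) = G (𝕢 w) = F w`.

Contents: `isLittleO_one_add_abs_log_pow_inv` (`(1 + |log x|) ^ N = o(x⁻¹)` at `0⁺`),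
`abs_im_invQParam_two_pi`, `differentiable_cuspFunction_of_growth` (the cusp function is entire),
`cuspFunction_eq_cuspFunction_reflect_inv` (`G q = G⁻ q⁻¹`), `periodic_tempered_entire_const`
(the theorem, for `Function.Periodic F (2π)`), and the registered stub
`stub_periodicTemperedLiouville` (verbatim signature; a one-line corollary).

Source: folklore / standard complex analysis (the same argument shows that a holomorphic modular
form of weight `0` is constant); no single citation. Deliberately not here: other periods (rescale
`z`), vector-valued `F`, growth measured only near `im z → ±∞`.
-/

noncomputable section

open Filter Asymptotics Function Set Metric Bornology Topology

namespace Summit.CriticalPhenomena.Ising3DConformalLimit.MoebiusLimitExistsOrbitLiouville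

/-- Growth of `log` at `0⁺` in the form fed to the removable singularity theorem:
`(1 + |log x|) ^ N = o(x⁻¹)` as `x → 0⁺`. [folklore] -/
theorem isLittleO_one_add_abs_log_pow_inv (N : ℕ) :
    (fun x : ℝ => (1 + |Real.log x|) ^ N) =o[𝓝[>] 0] fun x => x⁻¹ := by
  have h1 : (fun x : ℝ => (1 + |Real.log x|) ^ N) =O[𝓝[>] 0] fun x => |Real.log x| ^ N := by
    refine IsBigO.of_bound ((2 : ℝ) ^ N) ?_
    have hev : ∀ᶠ x : ℝ in 𝓝[>] 0, x < Real.exp (-1) :=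
      eventually_nhdsWithin_of_eventually_nhds (eventually_lt_nhds (Real.exp_pos _))
    filter_upwards [hev, self_mem_nhdsWithin] with x hx hx0
    have hx0' : 0 < x := hx0
    have hlog : Real.log x < -1 := (Real.log_lt_iff_lt_exp hx0').2 hx
    have habs : 1 ≤ |Real.log x| := by
      rw [abs_of_neg (by linarith)]
      linarith
    have hnn : 0 ≤ 1 + |Real.log x| := by positivity
    rw [Real.norm_of_nonneg (pow_nonneg hnn N),
      Real.norm_of_nonneg (pow_nonneg (abs_nonneg _) N), ← mul_pow]
    exact pow_le_pow_left₀ hnn (by linarith) N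
  have h2 : (fun x : ℝ => |Real.log x| ^ N) =o[𝓝[>] 0] fun x => x⁻¹ := by
    have := isLittleO_abs_log_rpow_rpow_nhdsGT_zero (s := -1) (N : ℝ) (by norm_num)
    simpa only [Real.rpow_natCast, Real.rpow_neg_one] using this
  exact h1.trans_isLittleO h2

/-- For the period `h = 2π` the `q`-parameter is `𝕢 z = exp (I z)`, and
`|im (invQParam (2π) q)| = |log ‖q‖|`. [folklore] -/
theorem abs_im_invQParam_two_pi (q : ℂ) :
    |(Periodic.invQParam (2 * Real.pi) q).im| = |Real.log ‖q‖| := by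
  rw [Periodic.im_invQParam, abs_mul, neg_div, abs_neg, div_self (by positivity), abs_one,
    one_mul]

variable {F : ℂ → ℂ} {C : ℝ} {N : ℕ}

/-- The cusp function `G = cuspFunction (2π) F` of a `2π`-periodic entire function `F` with
`‖F z‖ ≤ C * (1 + |im z|) ^ N` is entire: holomorphic off `0` by periodicity
(`Function.Periodic.differentiableAt_cuspFunction`), and at `0` by Riemann's removable singularity
theorem, since `‖G q‖ ≤ C * (1 + |log ‖q‖|) ^ N = o(‖q‖⁻¹)` as `q → 0`. [folklore] -/
theorem differentiable_cuspFunction_of_growth (hF : Differentiable ℂ F)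
    (hper : Periodic F (2 * Real.pi : ℝ)) (hgr : ∀ z, ‖F z‖ ≤ C * (1 + |z.im|) ^ N) :
    Differentiable ℂ (Periodic.cuspFunction (2 * Real.pi) F) := by
  have hh : (2 * Real.pi : ℝ) ≠ 0 := by positivity
  set G := Periodic.cuspFunction (2 * Real.pi) F with hG
  have hd0 : ∀ q : ℂ, q ≠ 0 → DifferentiableAt ℂ G q := fun q hq => by
    rw [← Periodic.qParam_right_inv hh hq]
    exact Periodic.differentiableAt_cuspFunction hh hper (hF _)
  have hd : DifferentiableOn ℂ G (univ \ {0}) := fun q hq =>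
    (hd0 q (mem_sdiff_singleton.1 hq).2).differentiableWithinAt
  have hbound : ∀ q : ℂ, q ≠ 0 → ‖G q‖ ≤ C * (1 + |Real.log ‖q‖|) ^ N := fun q hq => by
    rw [hG, Periodic.cuspFunction_eq_of_nonzero _ _ hq, ← abs_im_invQParam_two_pi q]
    exact hgr _
  have hO : (fun q => G q - G 0) =O[𝓝[≠] (0 : ℂ)] fun q => (1 + |Real.log ‖q‖|) ^ N := by
    refine IsBigO.of_bound (C + ‖G 0‖) ?_
    filter_upwards [self_mem_nhdsWithin] with q hq
    have hP1 : 1 ≤ (1 + |Real.log ‖q‖|) ^ N :=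
      one_le_pow₀ (le_add_of_nonneg_right (abs_nonneg _))
    rw [Real.norm_of_nonneg (zero_le_one.trans hP1), add_mul]
    exact (norm_sub_le _ _).trans
      (add_le_add (hbound q hq) (le_mul_of_one_le_right (norm_nonneg _) hP1))
  have ho : (fun q => G q - G 0) =o[𝓝[≠] (0 : ℂ)] fun q => (q - 0)⁻¹ := by
    refine hO.trans_isLittleO (IsLittleO.of_norm_right ?_)
    simpa only [Function.comp_def, norm_inv, sub_zero] using
      (isLittleO_one_add_abs_log_pow_inv N).comp_tendsto (tendsto_norm_nhdsNE_zero (E := ℂ))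
  have key := Complex.differentiableOn_update_limUnder_of_isLittleO univ_mem hd ho
  have hupd : update G 0 (limUnder (𝓝[≠] 0) G) = G := by
    rw [hG, ← Periodic.cuspFunction_zero_eq_limUnder_nhds_ne, update_eq_self]
  rw [hupd] at key
  exact differentiableOn_univ.1 key

/-- The cusp functions of `F` and of the reflected function `z ↦ F (-z)` are exchanged by
`q ↦ q⁻¹`: `cuspFunction h F q = cuspFunction h (F ∘ neg) q⁻¹` for `q ≠ 0` (because
`𝕢 h (-z) = (𝕢 h z)⁻¹`). [folklore] -/
theorem cuspFunction_eq_cuspFunction_reflect_inv {h : ℝ} (hh : h ≠ 0) (hper : Periodic F h)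
    {q : ℂ} (hq : q ≠ 0) :
    Periodic.cuspFunction h F q = Periodic.cuspFunction h (fun z => F (-z)) q⁻¹ := by
  have hperm : Periodic (fun z => F (-z)) h := fun x =>
    calc F (-(x + h)) = F (-(x + h) + h) := (hper _).symm
      _ = F (-x) := by congr 1; ring
  obtain ⟨u, rfl⟩ : ∃ u, Periodic.qParam h u = q := ⟨_, Periodic.qParam_right_inv hh hq⟩
  have hneg : (Periodic.qParam h u)⁻¹ = Periodic.qParam h (-u) := by
    simp only [Periodic.qParam, ← Complex.exp_neg]
    congr 1
    ring
  rw [hneg, Periodic.eq_cuspFunction hh hper, Periodic.eq_cuspFunction hh hperm, neg_neg]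

/-- **Liouville's theorem for periodic entire functions of tempered growth.** A `2π`-periodic
entire function `F : ℂ → ℂ` with `‖F z‖ ≤ C * (1 + |im z|) ^ N` for all `z` is constant.
[folklore] -/
theorem periodic_tempered_entire_const (hF : Differentiable ℂ F)
    (hper : Periodic F (2 * Real.pi : ℝ)) (hgr : ∀ z, ‖F z‖ ≤ C * (1 + |z.im|) ^ N) (z w : ℂ) :
    F z = F w := by
  have hh : (2 * Real.pi : ℝ) ≠ 0 := by positivity
  -- the reflected function `z ↦ F (-z)` satisfies the same hypotheses
  have hFm : Differentiable ℂ (fun z => F (-z)) := hF.comp differentiable_neg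
  have hperm : Periodic (fun z => F (-z)) (2 * Real.pi : ℝ) := fun x =>
    calc F (-(x + (2 * Real.pi : ℝ))) = F (-(x + (2 * Real.pi : ℝ)) + (2 * Real.pi : ℝ)) :=
        (hper _).symm
      _ = F (-x) := by congr 1; ring
  have hgrm : ∀ z, ‖(fun z => F (-z)) z‖ ≤ C * (1 + |z.im|) ^ N := fun z => by
    simpa only [Complex.neg_im, abs_neg] using hgr (-z)
  have hG := differentiable_cuspFunction_of_growth hF hper hgr
  have hGm := differentiable_cuspFunction_of_growth hFm hperm hgrm
  -- `G` is bounded: on the closed unit disc by compactness, outside it via `G q = G⁻ q⁻¹`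
  obtain ⟨M, hM⟩ := (isCompact_closedBall (0 : ℂ) 1).exists_bound_of_continuousOn
    hG.continuous.continuousOn
  obtain ⟨Mm, hMm⟩ := (isCompact_closedBall (0 : ℂ) 1).exists_bound_of_continuousOn
    hGm.continuous.continuousOn
  have hbdd : IsBounded (range (Periodic.cuspFunction (2 * Real.pi) F)) := by
    rw [isBounded_iff_forall_norm_le]
    refine ⟨max M Mm, ?_⟩
    rintro _ ⟨q, rfl⟩
    rcases le_or_gt ‖q‖ 1 with hq | hq
    · exact (hM q (mem_closedBall_zero_iff.2 hq)).trans (le_max_left _ _)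
    · have hq0 : q ≠ 0 := norm_pos_iff.1 (one_pos.trans hq)
      rw [cuspFunction_eq_cuspFunction_reflect_inv hh hper hq0]
      refine (hMm _ (mem_closedBall_zero_iff.2 ?_)).trans (le_max_right _ _)
      rw [norm_inv]
      exact inv_le_one_of_one_le₀ hq.le
  -- Liouville, and back to `F` through `F z = G (𝕢 z)`
  rw [← Periodic.eq_cuspFunction hh hper z, ← Periodic.eq_cuspFunction hh hper w]
  exact hG.apply_eq_apply_of_bounded hbdd _ _

/-- **Stub S1 of the line `Sketch` — Liouville for periodic tempered entire functions**
(registered signature, verbatim): a `2π`-periodic entire function of at most polynomial growth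
in `|Im z|` is constant. One-line corollary of `periodic_tempered_entire_const`. [folklore] -/
theorem stub_periodicTemperedLiouville :
    ∀ F : ℂ → ℂ, Differentiable ℂ F → (∀ z, F (z + 2 * Real.pi) = F z) →
      (∃ (C : ℝ) (N : ℕ), ∀ z, ‖F z‖ ≤ C * (1 + |z.im|) ^ N) → ∀ z w, F z = F w := by
  intro F hF hper hgr z w
  obtain ⟨C, N, hCN⟩ := hgr
  refine periodic_tempered_entire_const hF (fun x => ?_) hCN z w
  exact_mod_cast hper x

end Summit.CriticalPhenomena.Ising3DConformalLimit.MoebiusLimitExistsOrbitLiouville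

end
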